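import Summits.Ventures.AbcSig.Sieve.CharpolyCert

/-!
# Venture AbcSig — norm-form certificates UP TO SIGN (twist-stable `RefinesCPSym`), [BS04, Prop. 4.3] as printed

HONEST FRAMING. Certificate checker of a COMPUTATION cell (`pub-abcsig`); no Diophantine statement, no claim on ABC or
any summit. Why this file: a level file built on `Sieve/CharpolyCert.lean` names an orbit `o` by ONE formal generator
(`F = P_{ℓ'}`, the characteristic polynomial of `c_{ℓ'}` on the orbit, and the entry `c_{ℓ'} = θ`), so "the newforms
matching `o`" may include, besides the orbit itself, orbits sharing a factor of `P_{ℓ'}` — in practice its quadratic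
twists by characters `χ` with `χ(ℓ') = 1`, whose eigenvalues are `± c_ℓ`. The COMPUTED hypothesis is therefore stated
UP TO SIGN: `M.RefinesCPSym N o cp` = every newform matching `o` has, for each listed `ℓ`, `P_ℓ(c_ℓ) = 0` OR
`P_ℓ(−c_ℓ) = 0` (true for the orbit and for all its quadratic twists; the generator seat checks from the engine file that
nothing else matches `o` and says so in the level file). Since the allowed-trace sets `bs04Allowed ℓ` are symmetric
under `t ↦ −t` (`neg_mem_bs04Allowed`), the SAME Boolean `cpKills` / the SAME all-exponent check `cpCheck` of
`Sieve/CharpolySieve.lean` / `Sieve/CharpolyCert.lean` still give `M.ExcludesStd N o n`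
(`excludesStd_of_cpKills_sym`, `excludesStd_of_cpCheck_sym`). Plus the per-level list form `RefinesCPSymAll`.

Reference: [BS04] Bennett–Skinner, Canad. J. Math. 56 (2004), Prop. 4.3 and p. 42; Lemma 4.2 (allowed traces).
-/

namespace Summit.Ventures.AbcSig

/-- The allowed-trace sets of [BS04, Lemma 4.2] are symmetric under `t ↦ −t`. -/
theorem neg_mem_bs04Allowed {ℓ : ℕ} {t : ℤ} (h : t ∈ bs04Allowed ℓ) : -t ∈ bs04Allowed ℓ := by
  rw [mem_bs04Allowed_iff] at h ⊢
  rcases h with ⟨h1, h2⟩ | h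
  · left
    refine ⟨by omega, by nlinarith⟩
  · right
    rw [Int.natAbs_neg]
    exact h

/-- **COMPUTED HYPOTHESIS, up to sign** `M.RefinesCPSym N o cp`: every newform matching the data `o` has, for each
listed entry `(ℓ, P_ℓ)`, `P_ℓ(c_ℓ) = 0` or `P_ℓ(−c_ℓ) = 0`. (Intended: `P_ℓ` = characteristic polynomial of `c_ℓ` on the
orbit; true for the orbit and for its quadratic twists, which is everything that matches a one-generator `o` — checked by
the generator from the engine level file.) Weaker than `RefinesCP`. -/
def NewformModel.RefinesCPSym (M : NewformModel) (N : ℕ) (o : OrbitData) (cp : List CPEntry) : Prop :=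
  ∀ f : M.Form N, M.Matches f o → ∀ e ∈ cp, evalL (M.eig N f e.ell) e.P = 0 ∨ evalL (-M.eig N f e.ell) e.P = 0

/-- `RefinesCP` implies `RefinesCPSym`. -/
theorem NewformModel.RefinesCP.sym {M : NewformModel} {N : ℕ} {o : OrbitData} {cp : List CPEntry}
    (h : M.RefinesCP N o cp) : M.RefinesCPSym N o cp :=
  fun f hf e he => Or.inl (h f hf e he)

/-- **[BS04, Prop. 4.3], norm form, up to sign, one exponent.** If `cpKills cp bs04Allowed n N` and the newforms
matching `o` have the listed characteristic polynomials up to sign, then `M.ExcludesStd N o n`. Proof: `BS04Package`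
gives `ψ` with `ψ(c_ℓ) = t`, `t` allowed; if `P_ℓ(c_ℓ) = 0` then `n ∣ P_ℓ(t)`, and if `P_ℓ(−c_ℓ) = 0` then
`ψ(−c_ℓ) = −t` with `−t` allowed and `n ∣ P_ℓ(−t)`; either way the kill test is contradicted. -/
theorem NewformModel.excludesStd_of_cpKills_sym (M : NewformModel) (hP : M.BS04Package) {N : ℕ} (o : OrbitData)
    (cp : List CPEntry) (hRef : M.RefinesCPSym N o cp) (n : ℕ) (hkill : cpKills cp bs04Allowed n N = true) :
    M.ExcludesStd N o n := by
  intro S κ hS hn f hfo harises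
  obtain ⟨hA, hB, hC, hsq, hprime, h7, hndvd, hfree, hsol, hab1, hab2, hcase⟩ := hS
  obtain ⟨-, hmod⟩ := hP S κ hA hB hC hsq hprime h7 hndvd hfree hsol hab1 hab2 hcase
  obtain ⟨k, hk, hchar, ψ, hψ⟩ := hmod N f harises
  simp only [cpKills, List.any_eq_true, Bool.and_eq_true, decide_eq_true_eq, List.all_eq_true] at hkill
  obtain ⟨e, he, ⟨⟨⟨⟨hep, he2⟩, hen⟩, heN⟩, hall⟩⟩ := hkill
  obtain ⟨t, ht, hψt⟩ := hψ e.ell hep he2 (by rw [hn]; exact hen) heN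
  have hchar' : CharP k n := hn ▸ hchar
  rcases hRef f hfo e he with hroot | hroot
  · have h0 : ((hornerZ e.P t : ℤ) : k) = 0 := by
      rw [← map_evalL_eq_hornerZ ψ (M.eig N f e.ell) t hψt e.P, hroot, map_zero]
    have hdvd : (n : ℤ) ∣ hornerZ e.P t := (CharP.intCast_eq_zero_iff k n _).mp h0
    have hne := hall t ht
    simp only [bne_iff_ne, ne_eq] at hne
    exact hne (Int.emod_eq_zero_of_dvd hdvd)
  · have hψt' : ψ (-M.eig N f e.ell) = ((-t : ℤ) : k) := by rw [map_neg, hψt, Int.cast_neg]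
    have h0 : ((hornerZ e.P (-t) : ℤ) : k) = 0 := by
      rw [← map_evalL_eq_hornerZ ψ (-M.eig N f e.ell) (-t) hψt' e.P, hroot, map_zero]
    have hdvd : (n : ℤ) ∣ hornerZ e.P (-t) := (CharP.intCast_eq_zero_iff k n _).mp h0
    have hne := hall (-t) (neg_mem_bs04Allowed ht)
    simp only [bne_iff_ne, ne_eq] at hne
    exact hne (Int.emod_eq_zero_of_dvd hdvd)

/-- **[BS04, Prop. 4.3], norm form, up to sign, all exponents at once.** A checked all-exponent certificate
(`cpCheck`, `Sieve/CharpolyCert.lean`) with prime bases excludes `o` at every prime exponent `n` off the base list,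
modulo the CITED `BS04Package` and the COMPUTED `RefinesCPSym N o cp`. -/
theorem NewformModel.excludesStd_of_cpCheck_sym (M : NewformModel) (hP : M.BS04Package) {N : ℕ} (o : OrbitData)
    (cp : List CPEntry) (fac : List (ℕ × ℕ)) (h : cpCheck cp bs04Allowed N fac = true)
    (hprimes : ∀ pe ∈ fac, pe.1.Prime) (hRef : M.RefinesCPSym N o cp) (n : ℕ) (hn : n.Prime)
    (hmem : n ∉ fac.map Prod.fst) : M.ExcludesStd N o n :=
  M.excludesStd_of_cpKills_sym hP o cp hRef n (cpKills_of_cpCheck cp bs04Allowed N fac h hprimes n hn hmem)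

/-! ## Per-level bookkeeping -/

/-- **COMPUTED HYPOTHESIS, per level, up to sign**: every listed pair `(o, cp)` satisfies `M.RefinesCPSym N o cp`. -/
def NewformModel.RefinesCPSymAll (M : NewformModel) (N : ℕ) (L : List (OrbitData × List CPEntry)) : Prop :=
  ∀ oc ∈ L, M.RefinesCPSym N oc.1 oc.2

/-- `RefinesCPSymAll` of a concatenation is the conjunction. -/
theorem NewformModel.refinesCPSymAll_append (M : NewformModel) (N : ℕ) (L₁ L₂ : List (OrbitData × List CPEntry)) :
    M.RefinesCPSymAll N (L₁ ++ L₂) ↔ M.RefinesCPSymAll N L₁ ∧ M.RefinesCPSymAll N L₂ := by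
  unfold NewformModel.RefinesCPSymAll
  exact List.forall_mem_append

/-- Extracting one member of a `RefinesCPSymAll` hypothesis. -/
theorem NewformModel.RefinesCPSymAll.of_mem {M : NewformModel} {N : ℕ} {L : List (OrbitData × List CPEntry)}
    (h : M.RefinesCPSymAll N L) {o : OrbitData} {cp : List CPEntry} (hmem : (o, cp) ∈ L) :
    M.RefinesCPSym N o cp :=
  h (o, cp) hmem

/-- `RefinesCPAll` implies `RefinesCPSymAll`. -/
theorem NewformModel.RefinesCPAll.symAll {M : NewformModel} {N : ℕ} {L : List (OrbitData × List CPEntry)}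
    (h : M.RefinesCPAll N L) : M.RefinesCPSymAll N L :=
  fun oc hoc => (h oc hoc).sym

end Summit.Ventures.AbcSig
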